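import Literature.IUT.HodgeTheaters.PiAvatarNFKitSlots
import Literature.IUT.HodgeTheaters.PiAvatarNFCuspLabelsLift
import Literature.IUT.HodgeTheaters.PiAvatarLabelAutPM
import Literature.IUT.HodgeTheaters.InitialThetaDataTorsionMonodromyProofs
import HarnessLib

/-!
# `Aut(𝒟^⊚) ↠ 𝔽_l^⋇` and the NF-kit law `exists_aut_smul` at the genuine initial Θ-data, FROM the torsion-monodromy datum
# ([IUTchI] Ex 4.3 (i) «`Aut(C̲_K)/Aut_ε̲(C̲_K) ⥲ 𝔽_l^⋇`»; proof-only, post-freeze additive D13, not a cone member)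

S. Mochizuki, *Inter-universal Teichmüller theory I*, kurims manuscript (May 2020), Ex 4.3 (i) pp. 98–99 («the images of the groups
`Aut_ε̲(C̲_K)`, `Aut(C̲_K)` may be identified with the subgroups … `{(∗ ∗; 0 ±1)} ⊆ {(∗ ∗; 0 ∗)} ⊆ Im(G_{F_mod}) (⊇ SL₂(𝔽_l)/{±1})`»,
«natural isomorphisms … `Aut(C̲_K)/Aut_ε̲(C̲_K) ⥲ 𝔽_l^⋇`»), Def 4.1 (v) p. 97 («`LabCusp(†𝒟^⊚)` … natural `𝔽_l^⋇`-torsor structure»),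
Def 6.1 (v) p. 158 («`Aut(𝒟^{⊚±}) ↠ 𝔽_l^⋇`») ([IUTchI] Ex 4.3 (i) p.99) [claim: Mochizuki2012, status: disputed] (D-0012 claim key, series
status DISPUTED — kernel theorems over abc-iut-L5-t2's REAL `InitialThetaData`, abc-iut-L5-t1's `CuspGalois`, binder
`hS : D.CuspClassesNormaliserStable`, and abc-iut-L5-t8's DATUM `M : D.TorsionMonodromy` (post-freeze ADDITIVE binder-class
interface datum, FROZEN 9419245ad9809d9e — a NAMED DATUM, not constructed); nothing of the series is asserted, no side is taken on
[IUTchIII] Cor. 3.12).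

THE BOOKED REDUCTION, NOW THAT BOTH INPUTS ARE IN TREE (L5-lead RULINGS #46 (1) «write that reduction only when both are in tree»:
abc-iut-L5-t8 `toFlStarGlobal_surjective_of_torsionMonodromy` p433603 ✓ and abc-iut-L5-t4 g4 STEP 3 `toFlStarOnNormalizer_eq_mk_actFSlopeHom`
p436172 ✓): surjectivity of `toFlStarGlobal : Aut(𝒟^{⊚±}) → 𝔽_l^⋇` ⟹ surjectivity of abc-iut-L5-t3's slope character on `N(Π_{X̲_K})`
(`slope_surjective_of_toFlStarGlobal_surjective`) ⟹ surjectivity of `toFlStarNF : Aut(𝒟^⊚) → 𝔽_l^⋇` (the deck-translation lift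
`toFlStarNF_surjective_of_slope_surjective`, PiAvatarNFCuspLabelsLift) ⟹ the NF-kit law `exists_aut_smul` in the Type-0 slots
(`exists_aut_smul_iff_surjective`, PiAvatarNFKitSlots) and TRANSITIVITY of `Aut(𝒟^⊚)` on the genuine `LabCusp(𝒟^⊚)`.  Every statement
below is conditional ONLY on `CG`, `hS`, `M` (the `[Normal]` binder of `toFlStarGlobal` is t8's theorem `M.normal_PiXund_subgroupOf_PiXK`,
so it disappears from the NF-side statements); `[Aut(𝒟^⊚) : Ker] = l^⋇`.  No instance/notation; typed ≠ proved elsewhere.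
-/

noncomputable section

namespace Literature.IUT.HodgeTheaters

open CategoryTheory

universe u v w

section NFKitSurjective

variable {F : Type u} {K : Type v} {Fbar : Type w} [Field F] [NumberField F] [Field K] [NumberField K]
  [Algebra F K] [Field Fbar] [Algebra F Fbar] [Algebra K Fbar]
  {E : WeierstrassCurve F} [E.IsElliptic] {l : ℕ} {Pb : BadPlacePredicates K}
  (D : InitialThetaData F K Fbar E l Pb) (CG : D.geom.pe.CuspGalois) (hS : D.CuspClassesNormaliserStable)

namespace InitialThetaData

variable [Fact l.Prime]

/-- **From `𝒟^{⊚±}` to the slope character**: if `toFlStarGlobal : Aut(𝒟^{⊚±}) → 𝔽_l^⋇` is surjective then so is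
`n ↦ [actFSlope n]` on `N(Π_{X̲_K})` (t4's `toFlStarGlobal_autOfNormalizer` + STEP 3 `toFlStarOnNormalizer_eq_mk_actFSlopeHom`).
([IUTchI] Def 6.1 (v) p.158) [claim: Mochizuki2012, status: disputed] -/
theorem slope_surjective_of_toFlStarGlobal_surjective [(D.PiXund.subgroupOf D.PiXK).Normal]
    (h : Function.Surjective D.toFlStarGlobal) :
    Function.Surjective fun n : ↥(Subgroup.normalizer ((D.PiXund : Subgroup D.PiC) : Set D.PiC)) =>
      FlStar.mk l (D.actFSlopeUnit CG hS n) := by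
  intro j
  obtain ⟨α, hα⟩ := h j⁻¹
  obtain ⟨m, hm, rfl⟩ := OrbitCat.exists_eq_autOfNormalizer α
  refine ⟨⟨m, hm⟩, ?_⟩
  rw [D.toFlStarGlobal_autOfNormalizer, D.toFlStarOnNormalizer_eq_mk_actFSlopeHom CG hS, inv_inj] at hα
  exact hα

/-- **`toFlStarGlobal` surjective ⟹ `toFlStarNF` surjective** (`𝒟^{⊚±} ↠ 𝔽_l^⋇` descends to `𝒟^⊚ ↠ 𝔽_l^⋇` by the deck-translation
lift). ([IUTchI] Ex 4.3 (i) p.99) [claim: Mochizuki2012, status: disputed] -/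
theorem toFlStarNF_surjective_of_toFlStarGlobal_surjective [(D.PiXund.subgroupOf D.PiXK).Normal]
    (h : Function.Surjective D.toFlStarGlobal) : Function.Surjective (D.toFlStarNF CG hS) :=
  D.toFlStarNF_surjective_of_slope_surjective CG hS (D.slope_surjective_of_toFlStarGlobal_surjective CG hS h)

/-- **[IUTchI] Ex 4.3 (i) «`Aut(C̲_K)/Aut_ε̲(C̲_K) ⥲ 𝔽_l^⋇`» AT THE GENUINE DATA, surjectivity half: `toFlStarNF : Aut(𝒟^⊚) → 𝔽_l^⋇` is
SURJECTIVE, from abc-iut-L5-t8's torsion-monodromy datum** (`toFlStarGlobal_surjective_of_torsionMonodromy`; the `[Normal]` binder is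
t8's theorem). ([IUTchI] Ex 4.3 (i) p.99) [claim: Mochizuki2012, status: disputed] -/
theorem toFlStarNF_surjective_of_torsionMonodromy (M : D.TorsionMonodromy) : Function.Surjective (D.toFlStarNF CG hS) := by
  haveI := M.normal_PiXund_subgroupOf_PiXK
  exact D.toFlStarNF_surjective_of_toFlStarGlobal_surjective CG hS (D.toFlStarGlobal_surjective_of_torsionMonodromy M)

/-- … injectivity half is `gLabNFAutModel_eq_one_iff_toFlStarNF_eq_one` (the kernel = the automorphisms acting trivially on
`LabCusp(𝒟^⊚)`); hence **`[Aut(𝒟^⊚) : Ker(toFlStarNF)] = l^⋇`**. ([IUTchI] Ex 4.3 (i) p.99) [claim: Mochizuki2012, status: disputed] -/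
theorem index_ker_toFlStarNF_of_torsionMonodromy (M : D.TorsionMonodromy) : (D.toFlStarNF CG hS).ker.index = lStar l := by
  have hl : l ≠ 2 := by have := D.five_le_l; omega
  rw [Subgroup.index_ker, MonoidHom.range_eq_top.mpr (D.toFlStarNF_surjective_of_torsionMonodromy CG hS M), Subgroup.card_top,
    card_flStar l hl]

/-- **The NF-kit law `exists_aut_smul` at D13, DERIVED modulo the torsion-monodromy datum**: every label translation of
`GLabNF(𝒟^⊚) = 𝔽_l^⋇` is effected by an automorphism of the model object (PiAvatarNFKitSlots `exists_aut_smul_iff_surjective`).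
([IUTchI] Ex 4.3 (i) p.99) [claim: Mochizuki2012, status: disputed] -/
theorem exists_aut_smul_of_torsionMonodromy (M : D.TorsionMonodromy) (j : FlStar l) :
    ∃ b : D.gnfModel ≅ D.gnfModel, ∀ c : FlStar l, D.gLabNFMapSlot CG hS b c = j • c :=
  (D.exists_aut_smul_iff_surjective CG hS).mpr (D.toFlStarNF_surjective_of_torsionMonodromy CG hS M) j

/-- **`Aut(𝒟^⊚)` acts TRANSITIVELY on the genuine label classes `LabCusp(𝒟^⊚)`** (the `𝔽_l^⋇`-TORSOR structure of Def 4.1 (v) is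
realised by automorphisms: `LabCusp ≃ 𝔽_l^⋇` canonically and `Aut ↠ 𝔽_l^⋇` acts by multiplication), modulo the torsion-monodromy datum.
([IUTchI] Def 4.1 (v) p.97) [claim: Mochizuki2012, status: disputed] -/
theorem gLabNFAutModel_transitive_of_torsionMonodromy (M : D.TorsionMonodromy) (q q' : (D.gLabPMModel CG).AbsStar) :
    ∃ α : Aut (D.gBaseObj), D.gLabNFAutModel CG hS α q = q' := by
  obtain ⟨α, hα⟩ := D.toFlStarNF_surjective_of_torsionMonodromy CG hS M
    ((D.gLabPMModel CG).absStarEquiv q' * ((D.gLabPMModel CG).absStarEquiv q)⁻¹)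
  refine ⟨α, (D.gLabPMModel CG).absStarEquiv.injective ?_⟩
  rw [D.absStarEquiv_gLabNFAutModel CG hS, hα, inv_mul_cancel_right]

/-- … and with trivial stabilisers on labels: the action on `LabCusp(𝒟^⊚)` is SIMPLY transitive through `𝔽_l^⋇` — two automorphisms
agree on one (equivalently every) label class iff they have the same character. ([IUTchI] Ex 4.3 (i) p.99) [claim: Mochizuki2012, status: disputed] -/
theorem gLabNFAutModel_apply_eq_iff (α β : Aut (D.gBaseObj)) (q : (D.gLabPMModel CG).AbsStar) :
    D.gLabNFAutModel CG hS α q = D.gLabNFAutModel CG hS β q ↔ D.toFlStarNF CG hS α = D.toFlStarNF CG hS β := by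
  rw [← (D.gLabPMModel CG).absStarEquiv.injective.eq_iff, D.absStarEquiv_gLabNFAutModel CG hS,
    D.absStarEquiv_gLabNFAutModel CG hS, mul_left_inj]

end InitialThetaData

end NFKitSurjective

end Literature.IUT.HodgeTheaters
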